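import Summits.MatrixMultiplication.MatrixMultiplication.Theorems.SaturationLadderCuspModulus
import Summits.MatrixMultiplication.MatrixMultiplication.Theorems.FarEdgeDescentTowerBoxRate
import HarnessLib

/-!
# Route `SaturationLadder` on Strassen's spectrum, VIII: the cusp exponent COUPLED TO THE RATE DIAL

decomp-mm lens 1 «grading / quantitative ladder», gen 45, kernel K45-D (chain file 8, companion of file 7
`SaturationLadderCuspModulus`).  Def-free, sorry-free support beneath the deciding crux `SubexpSaturation`
(stmt-MatrixMultiplication-25909) of `route-MatrixMultiplication-SaturationLadder`; cut of record UNCHANGED.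
Notation as in file 7: universal spectral point `φ`, `θ = specMMPoint K φ`, darkness `d = θ₀+θ₁+θ₂−2`, height `θ₁`,
depth `ε₂ = 1−θ₂`, `u = log(θ₁/ε₂)`; `c₂ = (5 log(5/4) + 3 log 2)/3 = 1.0650…` (file 3's class ceiling).

File 7 localised the crux to the shallow cusp germ `{ε₂ > θ₁^{1+δ₀}}` for the FIXED exponent `δ₀ ≥ 50/21` read off
route `FarEdgeDescent`'s rate `RateBeyond (21/50)`.  This file makes the exponent a FUNCTION OF THE RATE DIAL, so that
every future improvement of the far-edge rate of record shrinks the open region of `h₁` with no new argument: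
* §1 ★★ `shallowCusp_iff_of_rateBeyond` (over `ℂ`): `RateBeyond θ` (`θ > 0`) ⟹ for every `δ₀ ≥ 1/θ`,
  `SubexpSaturation ⟺` the corner modulus law on the shallow germ `{θ₁ < η, u ≥ u₀, ε₂ > θ₁^{1+δ₀}}` (every `κ > 0`,
  some `η > 0`, `u₀`); ★ `phaseDiagram_of_rateBeyond` (law on the cusp of exponent `δ` PROVED when `κ > c₂` or
  `δ ≥ 1/θ`); ★ `shallowCusp_iff_of_allRates`: the TOP of the dial (every power rate) leaves, for EVERY `δ₀ > 0`,
  exactly the `δ₀`-shallow germ — the rate programme alone never reaches the edge `δ = 0` where the crux sits.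
* §2 instances at the CURRENT RATE OF RECORD (route `FarEdgeDescent`, kernel XXX-C2 `FarEdgeDescentTowerBoxRate`:
  `RateBeyond θ` for every `θ ≤ 11/25`, indeed for every `θ` below the certified sharp order
  `log₇(91/50)/(1 − log₇(91/50)) = 0.4445…`): `cuspModulus_rateRecord` (every field, every cusp `δ ≥ 25/11`, every
  `κ > 0`), `cuspModulus_beyond_sharpOrder` (every field, every `δ > (1 − log₇(91/50))/log₇(91/50) = 2.2495…`),
  `shallowCusp_iff_record` and `phaseDiagram_record` (over `ℂ`, `25/11` in place of file 7's `50/21`): the open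
  rectangle of the `(κ, δ)` diagram is now `(0, c₂] × [0, 25/11)`.

Nothing here proves `ω = 2` or an open item; no definitions (gate rule D-0009).  [cite: Strassen1988, Thm. 3.8]
[cite: LottiRomani1983, Prop. 4.1] [cite: CoppersmithWinograd1990, §8] [cite: Pan1984, Thm. 17.1]
[cite: AlmanLi2026, Proposition 4.2]
-/

set_option linter.dupNamespace false

noncomputable section

namespace Summit.MatrixMultiplication.MatrixMultiplication.Theorems.SaturationLadderCuspDial

open Literature.Computability.AlgebraicComplexity
open Summit.MatrixMultiplication.MatrixMultiplication.Theses.SaturationLadder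
open Summit.MatrixMultiplication.MatrixMultiplication.Theorems.SaturationLadderCornerModulus
open Summit.MatrixMultiplication.MatrixMultiplication.Theorems.SaturationLadderFaceModulus
open Summit.MatrixMultiplication.MatrixMultiplication.Theorems.SaturationLadderCuspModulus
open Summit.MatrixMultiplication.MatrixMultiplication.Theorems.FarEdgeDescentTowerBoxRate
  (rateBeyond_of_le_eleven_twentyFifths rateBeyond_of_lt_sharpOrder)

variable {K : Type} [Field K]

/-! ## §1 The shallow germ as a function of the rate dial (over `ℂ`) -/

/-- ★★ **DIAL-COUPLED LOCALISATION OF THE CRUX**: if `RateBeyond θ` holds over `ℂ` for some `θ > 0`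
(`∃ ρ > θ ∃ C ∀ integer k ≥ 1, ω(1,k,1) − (k+1) ≤ C·k^{−ρ}`), then for every `δ₀ ≥ 1/θ`:
`SubexpSaturation ⟺ ∀κ>0 ∃η>0 ∃u₀ ∀φ universal/ℂ: θ₂ < 1, u ≥ u₀, θ₁ < η, 1−θ₂ > θ₁^{1+δ₀} ⟹ (θ₀+θ₁+θ₂−2)·u ≤ κθ₁`.
(⟹ file 3's `subexpSaturation_iff_modulus`; ⟸ high points by `highModulus_of_holderFace` with `d ≤ 6ε₂^{2/7}`, deep
points by file 7's `cuspModulus_of_rateBeyond`, the germ by hypothesis.) [cite: Strassen1988, Thm. 3.8]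
[cite: LottiRomani1983, Prop. 4.1] -/
theorem shallowCusp_iff_of_rateBeyond {θ : ℝ} (hθ : 0 < θ)
    (hR : ∃ ρ C : ℝ, θ < ρ ∧ ∀ k : ℕ, 1 ≤ k → omegaRect ℂ 1 k 1 - (k + 1) ≤ C * (k : ℝ) ^ (-ρ))
    {δ₀ : ℝ} (hδ₀ : 1 / θ ≤ δ₀) :
    SubexpSaturation ↔ ∀ κ : ℝ, 0 < κ → ∃ η u₀ : ℝ, 0 < η ∧ ∀ F : SpectralMap ℂ, IsUniversalSpectralPoint ℂ F →
      specMMPoint ℂ F 2 < 1 → u₀ ≤ Real.log (specMMPoint ℂ F 1 / (1 - specMMPoint ℂ F 2)) →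
        specMMPoint ℂ F 1 < η → specMMPoint ℂ F 1 ^ (1 + δ₀) < 1 - specMMPoint ℂ F 2 →
          (specMMPoint ℂ F 0 + specMMPoint ℂ F 1 + specMMPoint ℂ F 2 - 2) *
              Real.log (specMMPoint ℂ F 1 / (1 - specMMPoint ℂ F 2)) ≤ κ * specMMPoint ℂ F 1 := by
  rw [subexpSaturation_iff_modulus]
  constructor
  · intro h κ hκ
    obtain ⟨u₀, hu₀⟩ := h κ hκ
    exact ⟨1, u₀, one_pos, fun F hF h2 hu _ _ => hu₀ F hF h2 hu⟩
  · intro h κ hκ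
    obtain ⟨η, u₁, hη, hS⟩ := h κ hκ
    obtain ⟨u₂, hH⟩ := highModulus_of_holderFace (K := ℂ) (by norm_num : (0 : ℝ) < 6)
      (by norm_num : (0 : ℝ) < 2 / 7) (fun _ hF => holderFace_two_sevenths hF) hη hκ
    obtain ⟨u₃, hD⟩ := cuspModulus_of_rateBeyond hθ hR hδ₀ hκ
    refine ⟨max u₁ (max u₂ u₃), fun F hF h2 hu => ?_⟩
    have hu₁ : u₁ ≤ _ := le_trans (le_max_left _ _) hu
    have hu₂ : u₂ ≤ _ := le_trans (le_trans (le_max_left _ _) (le_max_right _ _)) hu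
    have hu₃ : u₃ ≤ _ := le_trans (le_trans (le_max_right _ _) (le_max_right _ _)) hu
    rcases le_or_gt η (specMMPoint ℂ F 1) with hhigh | hlow
    · exact hH F hF h2 hu₂ hhigh
    rcases le_or_gt (1 - specMMPoint ℂ F 2) (specMMPoint ℂ F 1 ^ (1 + δ₀)) with hdeep | hshallow
    · exact hD F hF h2 hu₃ hdeep
    · exact hS F hF h2 hu₁ hlow hshallow

/-- ★ **DIAL-COUPLED PHASE DIAGRAM** (over `ℂ`): under `RateBeyond θ` (`θ > 0`) the corner modulus law on the cusp
`1−θ₂ ≤ θ₁^{1+δ}` holds beyond some `u₀` whenever `κ > c₂` (file 3) or `δ ≥ 1/θ` (file 7).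
[cite: CoppersmithWinograd1990, §8] [cite: LottiRomani1983, Prop. 4.1] -/
theorem phaseDiagram_of_rateBeyond {θ : ℝ} (hθ : 0 < θ)
    (hR : ∃ ρ C : ℝ, θ < ρ ∧ ∀ k : ℕ, 1 ≤ k → omegaRect ℂ 1 k 1 - (k + 1) ≤ C * (k : ℝ) ^ (-ρ))
    {κ δ : ℝ} (hκ : 0 < κ) (h : (5 * Real.log (5 / 4) + 3 * Real.log 2) / 3 < κ ∨ 1 / θ ≤ δ) :
    ∃ u₀ : ℝ, ∀ F : SpectralMap ℂ, IsUniversalSpectralPoint ℂ F → specMMPoint ℂ F 2 < 1 →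
      u₀ ≤ Real.log (specMMPoint ℂ F 1 / (1 - specMMPoint ℂ F 2)) →
        1 - specMMPoint ℂ F 2 ≤ specMMPoint ℂ F 1 ^ (1 + δ) →
          (specMMPoint ℂ F 0 + specMMPoint ℂ F 1 + specMMPoint ℂ F 2 - 2) *
              Real.log (specMMPoint ℂ F 1 / (1 - specMMPoint ℂ F 2)) ≤ κ * specMMPoint ℂ F 1 := by
  rcases h with hκ₂ | hδ
  · obtain ⟨u₀, hu₀⟩ := modulus_above_classCeiling κ hκ₂
    exact ⟨u₀, fun F hF h2 hu _ => hu₀ F hF h2 hu⟩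
  · exact cuspModulus_of_rateBeyond hθ hR hδ hκ

/-- ★ **THE TOP OF THE DIAL LEAVES EVERY SHALLOW GERM** (over `ℂ`): if `RateBeyond θ` holds for every `θ ≥ 0`, then
for EVERY `δ₀ > 0`, `SubexpSaturation ⟺` the corner modulus law on the `δ₀`-shallow germ `{θ₁ < η, u ≥ u₀,
1−θ₂ > θ₁^{1+δ₀}}`.  As `δ₀ ↓ 0` the germ GROWS to the whole off-face region (`1−θ₂ > θ₁` is vacuous off the face
for `u ≥ u₀ > 0`), so no family of power rates reaches the crux: the residual grade is the shallow edge `δ = 0`.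
[cite: LottiRomani1983, Prop. 4.1] [cite: Strassen1988, Thm. 3.8] -/
theorem shallowCusp_iff_of_allRates
    (hR : ∀ θ : ℝ, 0 ≤ θ → ∃ ρ C : ℝ, θ < ρ ∧ ∀ k : ℕ, 1 ≤ k → omegaRect ℂ 1 k 1 - (k + 1) ≤ C * (k : ℝ) ^ (-ρ))
    {δ₀ : ℝ} (hδ₀ : 0 < δ₀) :
    SubexpSaturation ↔ ∀ κ : ℝ, 0 < κ → ∃ η u₀ : ℝ, 0 < η ∧ ∀ F : SpectralMap ℂ, IsUniversalSpectralPoint ℂ F →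
      specMMPoint ℂ F 2 < 1 → u₀ ≤ Real.log (specMMPoint ℂ F 1 / (1 - specMMPoint ℂ F 2)) →
        specMMPoint ℂ F 1 < η → specMMPoint ℂ F 1 ^ (1 + δ₀) < 1 - specMMPoint ℂ F 2 →
          (specMMPoint ℂ F 0 + specMMPoint ℂ F 1 + specMMPoint ℂ F 2 - 2) *
              Real.log (specMMPoint ℂ F 1 / (1 - specMMPoint ℂ F 2)) ≤ κ * specMMPoint ℂ F 1 :=
  shallowCusp_iff_of_rateBeyond (one_div_pos.2 hδ₀) (hR (1 / δ₀) (by positivity)) (by rw [one_div_one_div])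

/-! ## §2 Instances at the current rate of record (route `FarEdgeDescent`, kernel XXX-C2) -/

/-- ★ **THE RATE OF RECORD CLEARS EVERY CUSP OF EXPONENT `≥ 25/11`** (every field, every `κ > 0`): from
`RateBeyond (11/25)` (`FarEdgeDescentTowerBoxRate.rateBeyond_of_le_eleven_twentyFifths`). [cite: Pan1984, Thm. 17.1]
[cite: LottiRomani1983, Prop. 4.1] -/
theorem cuspModulus_rateRecord {δ : ℝ} (hδ : 25 / 11 ≤ δ) {κ : ℝ} (hκ : 0 < κ) :
    ∃ u₀ : ℝ, ∀ F : SpectralMap K, IsUniversalSpectralPoint K F → specMMPoint K F 2 < 1 →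
      u₀ ≤ Real.log (specMMPoint K F 1 / (1 - specMMPoint K F 2)) →
        1 - specMMPoint K F 2 ≤ specMMPoint K F 1 ^ (1 + δ) →
          (specMMPoint K F 0 + specMMPoint K F 1 + specMMPoint K F 2 - 2) *
              Real.log (specMMPoint K F 1 / (1 - specMMPoint K F 2)) ≤ κ * specMMPoint K F 1 :=
  cuspModulus_of_rateBeyond (by norm_num : (0 : ℝ) < 11 / 25) (rateBeyond_of_le_eleven_twentyFifths K le_rfl)
    (by rw [one_div_div]; linarith) hκ

/-- ★ **… INDEED EVERY CUSP OF EXPONENT ABOVE THE RECIPROCAL SHARP ORDER** (every field, every `κ > 0`): for every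
`δ > (1 − log₇(91/50))/log₇(91/50) = 2.2495…`, from `RateBeyond θ` for all `θ` below the certified sharp order
`log₇(91/50)/(1 − log₇(91/50))` (`FarEdgeDescentTowerBoxRate.rateBeyond_of_lt_sharpOrder`), with `θ = 1/δ`.
[cite: Pan1984, Thm. 17.1] [cite: LottiRomani1983, Prop. 4.1] -/
theorem cuspModulus_beyond_sharpOrder {δ : ℝ}
    (hδ : (1 - Real.logb 7 ((91 : ℝ) / 50)) / Real.logb 7 ((91 : ℝ) / 50) < δ) {κ : ℝ} (hκ : 0 < κ) :
    ∃ u₀ : ℝ, ∀ F : SpectralMap K, IsUniversalSpectralPoint K F → specMMPoint K F 2 < 1 →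
      u₀ ≤ Real.log (specMMPoint K F 1 / (1 - specMMPoint K F 2)) →
        1 - specMMPoint K F 2 ≤ specMMPoint K F 1 ^ (1 + δ) →
          (specMMPoint K F 0 + specMMPoint K F 1 + specMMPoint K F 2 - 2) *
              Real.log (specMMPoint K F 1 / (1 - specMMPoint K F 2)) ≤ κ * specMMPoint K F 1 := by
  set L : ℝ := Real.logb 7 ((91 : ℝ) / 50) with hLdef
  have hL0 : 0 < L := Real.logb_pos (by norm_num) (by norm_num)
  have hL1 : L < 1 := by
    rw [hLdef, Real.logb_lt_iff_lt_rpow (by norm_num) (by norm_num), Real.rpow_one]; norm_num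
  have hq : 0 < (1 - L) / L := div_pos (by linarith) hL0
  have hδ0 : 0 < δ := lt_trans hq hδ
  have hθ : 1 / δ < L / (1 - L) := by
    rw [one_div_lt hδ0 (div_pos hL0 (by linarith)), one_div_div]; exact hδ
  exact cuspModulus_of_rateBeyond (one_div_pos.2 hδ0) (rateBeyond_of_lt_sharpOrder K hθ)
    (by rw [one_div_one_div]) hκ

/-- ★★ **LOCALISATION AT THE RATE OF RECORD** (over `ℂ`): for any `δ₀ ≥ 25/11`, `SubexpSaturation ⟺` the corner
modulus law on the shallow germ `{θ₁ < η, u ≥ u₀, 1−θ₂ > θ₁^{1+δ₀}}` (file 7's `subexpSaturation_iff_shallowCusp` had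
`δ₀ ≥ 50/21`). [cite: Strassen1988, Thm. 3.8] [cite: Pan1984, Thm. 17.1] -/
theorem shallowCusp_iff_record {δ₀ : ℝ} (hδ₀ : 25 / 11 ≤ δ₀) :
    SubexpSaturation ↔ ∀ κ : ℝ, 0 < κ → ∃ η u₀ : ℝ, 0 < η ∧ ∀ F : SpectralMap ℂ, IsUniversalSpectralPoint ℂ F →
      specMMPoint ℂ F 2 < 1 → u₀ ≤ Real.log (specMMPoint ℂ F 1 / (1 - specMMPoint ℂ F 2)) →
        specMMPoint ℂ F 1 < η → specMMPoint ℂ F 1 ^ (1 + δ₀) < 1 - specMMPoint ℂ F 2 →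
          (specMMPoint ℂ F 0 + specMMPoint ℂ F 1 + specMMPoint ℂ F 2 - 2) *
              Real.log (specMMPoint ℂ F 1 / (1 - specMMPoint ℂ F 2)) ≤ κ * specMMPoint ℂ F 1 :=
  shallowCusp_iff_of_rateBeyond (by norm_num : (0 : ℝ) < 11 / 25) (rateBeyond_of_le_eleven_twentyFifths ℂ le_rfl)
    (by rw [one_div_div]; linarith)

/-- ★★ **THE `(κ, δ)` PHASE DIAGRAM AT THE RATE OF RECORD** (over `ℂ`): the corner modulus law on the cusp of
exponent `δ` holds beyond some `u₀` whenever `κ > c₂ = (5 log(5/4) + 3 log 2)/3` or `δ ≥ 25/11`; the open rectangle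
is `(0, c₂] × [0, 25/11)`, the deciding crux its corner at `δ = 0`. [cite: CoppersmithWinograd1990, §8]
[cite: Pan1984, Thm. 17.1] -/
theorem phaseDiagram_record {κ δ : ℝ} (hκ : 0 < κ)
    (h : (5 * Real.log (5 / 4) + 3 * Real.log 2) / 3 < κ ∨ 25 / 11 ≤ δ) :
    ∃ u₀ : ℝ, ∀ F : SpectralMap ℂ, IsUniversalSpectralPoint ℂ F → specMMPoint ℂ F 2 < 1 →
      u₀ ≤ Real.log (specMMPoint ℂ F 1 / (1 - specMMPoint ℂ F 2)) →
        1 - specMMPoint ℂ F 2 ≤ specMMPoint ℂ F 1 ^ (1 + δ) →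
          (specMMPoint ℂ F 0 + specMMPoint ℂ F 1 + specMMPoint ℂ F 2 - 2) *
              Real.log (specMMPoint ℂ F 1 / (1 - specMMPoint ℂ F 2)) ≤ κ * specMMPoint ℂ F 1 := by
  rcases h with hκ₂ | hδ
  · exact phaseDiagram_of_rateBeyond (by norm_num : (0 : ℝ) < 11 / 25)
      (rateBeyond_of_le_eleven_twentyFifths ℂ le_rfl) hκ (Or.inl hκ₂)
  · exact cuspModulus_rateRecord hδ hκ

end Summit.MatrixMultiplication.MatrixMultiplication.Theorems.SaturationLadderCuspDial

end
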